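/-
Copyright (c) 2026 the pub-hodgecm-mathlib formalisation cell (harness21).  Prover seat hodgecm-mathlib-K2E3-p25 (g4), Track B «K2-LIT», E3 hand on loan to L1
(hLiu418 = `stmt-HodgeConjecture-24832`); LEAD F0P6-plan (g14) BATCH #139 (2) «`…IndexValueTwoGram` §1–§3 GO»; line lead (K1a-GK) K2E5-p16 (g8); sequel of
★ p862841 `K2LiuRankOneIndexValueTwo`.  THEOREMS ONLY (`--supports stmt-HodgeConjecture-24832 --as helper`): no definition, no instance, no notation,
no named-fact hypothesis, no `sorry`.
-/
import Summits.HodgeConjecture.HodgeConjecture.Theorems.K2LiuRankOneIndexValueTwo   -- ★ p862841: `gramRL_apply`, `skew_entry`, `det_eq_two_by_two`, `diag_ne_zero_or`, `val₂_mul_sq_mul`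
import HarnessLib

/-!
# Crux `HLiu418`, #42S organ S5, letter (V-b), §3 «GRAM PRESENTATION»: the hermitian matrix `β = α·T·X` of a rank-one skew index IS
# `(val₂ X · θ · T_bb) · c(u) ⊗ u` with `u_k = 1` — the norm class of the index in `vecMulVec` currency

Cell `hodgecm-mathlib`, crux item hLiu418 = `stmt-HodgeConjecture-24832`; squad K2, prover K2E3-p25 (g4); count-neutral helper.
Namespace `Summit.HodgeConjecture.HodgeConjecture.Cruxes.HLiu418.K2LiuRankOneIndexValueTwoGram` (generic index `n`, `e : Fin 2 × Fin 1 ≃ Fin n`, `a := e (0,0)`,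
`b := e (1,0)`, exactly ★ p862841's frame).

* §1 the hermitian matrix of a skew index: `gram_apply` (`(α·T_L·X) i j = α · T_ii · X_ij`), **`gram_map_transpose`** (`(c β)ᵀ = β` for `X ∈ Skew_T`, `c α = −α`),
  `det_gram` (`det β = αⁿ · det T_L · det X`), `eq_of_entries` (two matrices on `Fin n ≃ Fin 2` agree iff their four entries do).
* §2 **`exists_gram_presentation`**: for `X ∈ Skew_T`, `X ≠ 0`, `det X = 0`: `∃ k u, u k = 1 ∧ X k k ≠ 0 ∧ α • (T_L * X) = (val₂ X · α² · T_bb) • vecMulVec (c ∘ u) u`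
  — the RANK-ONE STRUCTURE («rank one = the class of `diag(b, 0)`», ★ `K2LiuRankOneLineGram` §2 at `Fin 2`) written directly on `Fin n` at the branch index `k` of
  ★ `val₂_mul_sq_mul`, with `u := (β k ·) ∕ β k k`; the `(k′,k′)` entry is the determinant relation.  Consequently every Gram value of the index (every `b′` with
  `β = b′ · c(u′) ⊗ u′`, `u′` unimodular) is `val₂ X · θ · T_bb` TIMES A NORM (★ `eq_mul_conj_mul_self_of_smul_vecMulVec_eq`).
[KudlaRallis1994, §3] [Scharlau1985HermitianForms, Ch. 10 §1] [Shimura1997, §18.4] [MoeglinWaldspurger1995, I.2.6].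

HONEST LABEL.  Count-neutral helper: `HC_CM` is proved only modulo the 7 printed citations (2 remaining named inputs: hLiu418 = `stmt-HodgeConjecture-24832`,
h413 = `stmt-HodgeConjecture-24833`) until rung 0 closes; seam algebra for the (o1)∕K1a-GK letters, closes no socket by itself.
-/

set_option autoImplicit false
set_option linter.dupNamespace false -- the mandated namespace repeats `HodgeConjecture.HodgeConjecture`

noncomputable section

open scoped Matrix
open NumberField IsDedekindDomain
open Literature.NumberTheory.Automorphic
open Literature.NumberTheory.GelbartRogawski1991 Literature.NumberTheory.GelbartRogawski1991.GRConstruction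
open Summit.HodgeConjecture.HodgeConjecture.Cruxes.HLiu418.K2LiuSiegelUnipotentFourierDefs
open Summit.HodgeConjecture.HodgeConjecture.Cruxes.HLiu418.K2LiuRankOneIndexValue
open Summit.HodgeConjecture.HodgeConjecture.Cruxes.HLiu418.K2LiuRankOneIndexValueTwo

namespace Summit.HodgeConjecture.HodgeConjecture.Cruxes.HLiu418.K2LiuRankOneIndexValueTwoGram

variable (L : Type) [Field L] [NumberField L] [IsCMField L]
variable {n : ℕ} (e : Fin 2 × Fin 1 ≃ Fin n)
  (dV : Fin 2 → L) (hdV : ∀ i, IsCMField.complexConj L (dV i) = dV i) (hdV0 : ∀ i, dV i ≠ 0)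
  (dW : Fin 1 → L) (hdW : ∀ i, IsCMField.complexConj L (dW i) = dW i) (hdW0 : ∀ i, dW i ≠ 0)

/-! ## §1 The hermitian matrix `β = α · T_L · X` of a skew index -/

/-- `(α · T_L · X) i j = α · T_ii · X_ij` (`T_L` diagonal). [folklore] -/
theorem gram_apply (α : L) (X : Matrix (Fin n) (Fin n) L) (i j : Fin n) :
    (α • ((gramR L e dV hdV dW hdW).map (algebraMap (Fp L) L) * X)) i j = α * ((gramR L e dV hdV dW hdW).map (algebraMap (Fp L) L)) i i * X i j := by
  rw [Matrix.smul_apply, smul_eq_mul, gramR_eq_diagonal, Matrix.diagonal_map (map_zero _), Matrix.diagonal_mul, Matrix.diagonal_apply_eq, mul_assoc]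

/-- **`β = α · T_L · X` IS `c`-HERMITIAN** for `X ∈ Skew_T` and `c α = −α`: `(c β)ᵀ = β` — entry `(i,j)` of `(c β)ᵀ` is `c(α T_jj X_ji) = −α T_jj c(X_ji) = α T_ii X_ij`
by the skew relation ★ `skew_entry`. [cite: Shimura1997, §18.1] [cite: Scharlau1985HermitianForms, Ch. 10 §1] -/
theorem gram_map_transpose {α : L} (hαc : IsCMField.complexConj L α = -α) {X : Matrix (Fin n) (Fin n) L}
    (hX : X ∈ skewMatrices ((IsCMField.complexConj L : L ≃ₐ[Fp L] L) : L →+* L) ((gramR L e dV hdV dW hdW).map (algebraMap (Fp L) L))) :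
    ((α • ((gramR L e dV hdV dW hdW).map (algebraMap (Fp L) L) * X)).map ((IsCMField.complexConj L : L ≃ₐ[Fp L] L) : L →+* L))ᵀ =
      α • ((gramR L e dV hdV dW hdW).map (algebraMap (Fp L) L) * X) := by
  ext i j
  rw [Matrix.transpose_apply, Matrix.map_apply, gram_apply, gram_apply, RingHom.coe_coe, map_mul, map_mul, hαc, complexConj_gramRL_apply_same]
  have h := skew_entry L e dV hdV dW hdW hX i j
  -- `T_ii X_ij = −c(X_ji) T_jj`
  linear_combination (-α) * h

/-- the diagonal entries of `β` are real: `c(β k k) = β k k`. [cite: Scharlau1985HermitianForms, Ch. 10 §1] -/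
theorem conj_gram_apply_same {α : L} (hαc : IsCMField.complexConj L α = -α) {X : Matrix (Fin n) (Fin n) L}
    (hX : X ∈ skewMatrices ((IsCMField.complexConj L : L ≃ₐ[Fp L] L) : L →+* L) ((gramR L e dV hdV dW hdW).map (algebraMap (Fp L) L))) (k : Fin n) :
    IsCMField.complexConj L ((α • ((gramR L e dV hdV dW hdW).map (algebraMap (Fp L) L) * X)) k k) =
      (α • ((gramR L e dV hdV dW hdW).map (algebraMap (Fp L) L) * X)) k k := by
  have h := congrFun (congrFun (gram_map_transpose L e dV hdV dW hdW hαc hX) k) k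
  rwa [Matrix.transpose_apply, Matrix.map_apply, RingHom.coe_coe] at h

/-- the off-diagonal entries of `β` are conjugate: `c(β i j) = β j i`. [cite: Scharlau1985HermitianForms, Ch. 10 §1] -/
theorem conj_gram_apply {α : L} (hαc : IsCMField.complexConj L α = -α) {X : Matrix (Fin n) (Fin n) L}
    (hX : X ∈ skewMatrices ((IsCMField.complexConj L : L ≃ₐ[Fp L] L) : L →+* L) ((gramR L e dV hdV dW hdW).map (algebraMap (Fp L) L))) (i j : Fin n) :
    IsCMField.complexConj L ((α • ((gramR L e dV hdV dW hdW).map (algebraMap (Fp L) L) * X)) i j) =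
      (α • ((gramR L e dV hdV dW hdW).map (algebraMap (Fp L) L) * X)) j i := by
  have h := congrFun (congrFun (gram_map_transpose L e dV hdV dW hdW hαc hX) j) i
  rwa [Matrix.transpose_apply, Matrix.map_apply, RingHom.coe_coe] at h

/-- `det (α · T_L · X) = αⁿ · det T_L · det X`. [folklore] -/
theorem det_gram (α : L) (X : Matrix (Fin n) (Fin n) L) :
    (α • ((gramR L e dV hdV dW hdW).map (algebraMap (Fp L) L) * X)).det = α ^ n * ((gramR L e dV hdV dW hdW).map (algebraMap (Fp L) L)).det * X.det := by
  rw [Matrix.det_smul, Matrix.det_mul, Fintype.card_fin, mul_assoc]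

omit [NumberField L] [IsCMField L] in
/-- two matrices on `Fin n ≃ Fin 2` agree iff their four entries at `a = e(0,0)`, `b = e(1,0)` agree. [folklore] -/
theorem eq_of_entries {A B : Matrix (Fin n) (Fin n) L} (haa : A (e (0, 0)) (e (0, 0)) = B (e (0, 0)) (e (0, 0)))
    (hab : A (e (0, 0)) (e (1, 0)) = B (e (0, 0)) (e (1, 0))) (hba : A (e (1, 0)) (e (0, 0)) = B (e (1, 0)) (e (0, 0)))
    (hbb : A (e (1, 0)) (e (1, 0)) = B (e (1, 0)) (e (1, 0))) : A = B := by
  rw [← sub_eq_zero]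
  exact eq_zero_of_entries L e (by rw [Matrix.sub_apply, haa, sub_self]) (by rw [Matrix.sub_apply, hab, sub_self])
    (by rw [Matrix.sub_apply, hba, sub_self]) (by rw [Matrix.sub_apply, hbb, sub_self])

/-! ## §2 The Gram presentation at the branch index of `val₂` -/

include hdV0 hdW0 in
open scoped Classical in
/-- **THE GRAM PRESENTATION OF A RANK-ONE SKEW INDEX.**  For `X ∈ Skew_T(L)`, `X ≠ 0`, `det X = 0` there are an index `k` (`X_kk ≠ 0`; `k = b` on the corner branch of
`val₂`, `k = a` otherwise) and a vector `u` with `u_k = 1` such that the hermitian matrix `β = α·T_L·X` is `(val₂ X · α² · T_bb) · c(u) ⊗ u` — «rank one = the class of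
`diag(val₂ X · θ · T_bb, 0)`».  `u := (β k ·)∕β k k`; the `(k′, k′)` entry is the determinant relation `β_aa β_bb = β_ab β_ba = β_ab c(β_ab)`.
[cite: KudlaRallis1994, §3] [cite: Scharlau1985HermitianForms, Ch. 10 §1] [cite: Shimura1997, §18.4] -/
theorem exists_gram_presentation {α : L} (hα0 : α ≠ 0) (hαc : IsCMField.complexConj L α = -α) {X : Matrix (Fin n) (Fin n) L}
    (hX : X ∈ skewMatrices ((IsCMField.complexConj L : L ≃ₐ[Fp L] L) : L →+* L) ((gramR L e dV hdV dW hdW).map (algebraMap (Fp L) L))) (hX0 : X ≠ 0)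
    (hdet : X.det = 0) :
    ∃ (k : Fin n) (u : Fin n → L), u k = 1 ∧ X k k ≠ 0 ∧
      α • ((gramR L e dV hdV dW hdW).map (algebraMap (Fp L) L) * X) =
        (((if (⟨(X (e (1, 0)) (e (1, 0)) - IsCMField.complexConj L (X (e (1, 0)) (e (1, 0)))) * (2 * α)⁻¹, imPart_mem L hαc _⟩ : ↥(maximalRealSubfield L)) = 0 then
              (gramR L e dV hdV dW hdW) (e (0, 0)) (e (0, 0)) * ((gramR L e dV hdV dW hdW) (e (1, 0)) (e (1, 0)))⁻¹ *
                (⟨(X (e (0, 0)) (e (0, 0)) - IsCMField.complexConj L (X (e (0, 0)) (e (0, 0)))) * (2 * α)⁻¹, imPart_mem L hαc _⟩ : ↥(maximalRealSubfield L))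
            else ⟨(X (e (1, 0)) (e (1, 0)) - IsCMField.complexConj L (X (e (1, 0)) (e (1, 0)))) * (2 * α)⁻¹, imPart_mem L hαc _⟩ : ↥(maximalRealSubfield L)) : L) *
            α ^ 2 * ((gramR L e dV hdV dW hdW).map (algebraMap (Fp L) L)) (e (1, 0)) (e (1, 0))) •
          Matrix.vecMulVec (((IsCMField.complexConj L : L ≃ₐ[Fp L] L) : L →+* L) ∘ u) u := by
  obtain ⟨k, hXk, hval⟩ := val₂_mul_sq_mul L e dV hdV hdV0 dW hdW hdW0 hα0 hαc hX hX0 hdet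
  rw [hval]
  -- abbreviations: `β`, its branch entry `β_kk ≠ 0`
  set β : Matrix (Fin n) (Fin n) L := α • ((gramR L e dV hdV dW hdW).map (algebraMap (Fp L) L) * X) with hβ
  have hβkk : β k k = α * ((gramR L e dV hdV dW hdW).map (algebraMap (Fp L) L)) k k * X k k := gram_apply L e dV hdV dW hdW α X k k
  have hβkk0 : β k k ≠ 0 := by
    rw [hβkk]; exact mul_ne_zero (mul_ne_zero hα0 (gramRL_apply_same_ne_zero L e dV hdV hdV0 dW hdW hdW0 k)) hXk
  have hconj : ∀ i j, IsCMField.complexConj L (β i j) = β j i := conj_gram_apply L e dV hdV dW hdW hαc hX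
  -- the determinant relation `β_aa β_bb = β_ab β_ba`
  have hdetβ : β (e (0, 0)) (e (0, 0)) * β (e (1, 0)) (e (1, 0)) = β (e (0, 0)) (e (1, 0)) * β (e (1, 0)) (e (0, 0)) := by
    have h : β.det = 0 := by
      rw [hβ, Matrix.det_smul, Matrix.det_mul, hdet, mul_zero, mul_zero]
    rw [det_eq_two_by_two L e β] at h
    exact sub_eq_zero.1 h
  refine ⟨k, fun j => β k j / β k k, div_self hβkk0, hXk, ?_⟩
  rw [← hβkk]
  -- `k` is `a` or `b`
  obtain ⟨i, hi⟩ : ∃ i : Fin 2, k = e (i, 0) := by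
    obtain ⟨⟨i, j⟩, hij⟩ := e.surjective k
    exact ⟨i, by rw [← hij, Subsingleton.elim j 0]⟩
  -- the four entries of the candidate presentation
  have hE : ∀ p q : Fin n, (β k k • Matrix.vecMulVec (((IsCMField.complexConj L : L ≃ₐ[Fp L] L) : L →+* L) ∘ fun j => β k j / β k k)
      (fun j => β k j / β k k)) p q = β k k * (IsCMField.complexConj L (β k p) / β k k * (β k q / β k k)) := fun p q => by
    rw [Matrix.smul_apply, Matrix.vecMulVec_apply, Function.comp_apply, RingHom.coe_coe, map_div₀, smul_eq_mul]
    rw [show IsCMField.complexConj L (β k k) = β k k from hconj k k]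
  -- entry identities at the branch index `k` and the other index
  have hkk : β k k = β k k * (IsCMField.complexConj L (β k k) / β k k * (β k k / β k k)) := by
    rw [hconj k k, div_self hβkk0, one_mul, mul_one]
  have hkq : ∀ q, β k q = β k k * (IsCMField.complexConj L (β k k) / β k k * (β k q / β k k)) := fun q => by
    rw [hconj k k, div_self hβkk0, one_mul, ← mul_div_assoc, mul_div_cancel_left₀ _ hβkk0]
  have hpk : ∀ p, β p k = β k k * (IsCMField.complexConj L (β k p) / β k k * (β k k / β k k)) := fun p => by
    rw [hconj k p, div_self hβkk0, mul_one, ← mul_div_assoc, mul_div_cancel_left₀ _ hβkk0]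
  have hother : ∀ p, β k k * β p p = β k p * β p k →
      β p p = β k k * (IsCMField.complexConj L (β k p) / β k k * (β k p / β k k)) := fun p hrel => by
    rw [hconj k p]
    field_simp
    linear_combination hrel
  fin_cases i
  · -- `k = a`
    simp only [Fin.zero_eta, Fin.isValue] at hi
    subst hi
    refine eq_of_entries L e ?_ ?_ ?_ ?_
    · rw [hE]; exact hkk
    · rw [hE]; exact hkq _
    · rw [hE]; exact hpk _
    · rw [hE]; exact hother _ (by rw [hdetβ])
  · -- `k = b`
    simp only [Fin.mk_one, Fin.isValue] at hi
    subst hi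
    refine eq_of_entries L e ?_ ?_ ?_ ?_
    · rw [hE]; exact hother _ (by rw [mul_comm, hdetβ, mul_comm])
    · rw [hE]; exact hpk _
    · rw [hE]; exact hkq _
    · rw [hE]; exact hkk

end Summit.HodgeConjecture.HodgeConjecture.Cruxes.HLiu418.K2LiuRankOneIndexValueTwoGram

end
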